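import Mathlib
import Literature.NumberTheory.Transcendental.KZSliceFubini
import Summits.KontsevichZagierPeriods.Zeta5Search.RhinViolaGenerators
import Summits.KontsevichZagierPeriods.Zeta5Search.BarnesCube
import HarnessLib

/-!
# ζ(5) search — absolute convergence of the Rhin–Viola triple integrals with complex exponents; product slices of the cube (cell `pub-zeta5`, seat ct-1 g13)

HONEST FRAMING: systematic search; no irrationality claim unless kernel-certified. Nothing in this file is an
irrationality result, a worthiness exponent or a denominator statement. On the Bailey-free (Rhin–Viola) route to
Brown–Zudilin's generators `h, h'` [BrownZudilin2022, Sect. 7] (memo `ct-1/g12/EULERSYM.md` §5) the hypergeometric moves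
`φ, χ` with complex exponents (`RhinViolaGeneratorsComplex.lean`) carry the integrability of the integrands
`x^h(1−x)^l y^k(1−y)^s z^j(1−z)^q (1−(1−xy)z)^{−c}` on `(0,1)³` as hypotheses, and the Mellin decoupling of the `t`-side of
(10) needs Fubini on `(0,1)⁵ × ℝ`. This file supplies:

* `integral_cube_cons_mul`, `integrableOn_cube_cons_mul` — peeling the first coordinate of `(0,1)ⁿ⁺¹` off a product
  integrand `f(y₀)·G(y₁,…,yₙ)` (Fubini for a product, `KZ.measurePreserving_vecCons`);
* `setIntegral_cube3_rev` — the coordinate reversal of `(0,1)³` for vector-valued integrands;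
* `link_rpow_le` — the elementary domination `(1−(1−xy)z)^{−(α+β)} ≤ (xy)^{−β}(1−z)^{−α}` (`α, β ≥ 0`) from
  `1−(1−xy)z ≥ xy` and `≥ 1−z`;
* **`rv_integrableOn_cpow`** — the complex-exponent RV integrand is integrable on `(0,1)³` as soon as
  `Re h, Re l, Re k, Re s, Re j, Re q > −1` and `Re c < min(Re h, Re k) + Re q + 2` (the singular locus of the link is
  `{z = 1, xy = 0}`); proof by domination with a product of three Beta integrands.

Theorems only (no new definitions).
-/

noncomputable section

namespace Summit.KontsevichZagierPeriods.Zeta5Search.RhinViolaIntegrable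

open MeasureTheory Set Filter
open Literature.NumberTheory.Transcendental (KZ.measurePreserving_vecCons KZ.measurableEmbedding_vecCons)
open Summit.KontsevichZagierPeriods.Zeta5Search.RhinViolaGenerators (mem_cube measurableSet_cube link_pos)
open Summit.KontsevichZagierPeriods.Zeta5Search.BarnesCube (integrableOn_beta_Ioo')

/-! ### 1. Peeling the first coordinate of the cube off a product integrand -/

/-- `vecCons s x ∈ (0,1)ⁿ⁺¹` iff `s ∈ (0,1)` and `x ∈ (0,1)ⁿ`. -/
theorem vecCons_mem_cube_iff (n : ℕ) (s : ℝ) (x : Fin n → ℝ) :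
    Matrix.vecCons s x ∈ (univ.pi fun _ : Fin (n + 1) => Ioo (0:ℝ) 1) ↔
      s ∈ Ioo (0:ℝ) 1 ∧ x ∈ (univ.pi fun _ : Fin n => Ioo (0:ℝ) 1) := by
  simp only [mem_univ_pi, Fin.forall_fin_succ, Matrix.cons_val_zero, Matrix.cons_val_succ, mem_Ioo]

/-- The preimage of `(0,1)ⁿ⁺¹` under `(s, x) ↦ vecCons s x` is `(0,1) × (0,1)ⁿ`. -/
theorem vecCons_preimage_cube (n : ℕ) :
    (fun p : ℝ × (Fin n → ℝ) => Matrix.vecCons p.1 p.2) ⁻¹' (univ.pi fun _ : Fin (n + 1) => Ioo (0:ℝ) 1) =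
      Ioo (0:ℝ) 1 ×ˢ (univ.pi fun _ : Fin n => Ioo (0:ℝ) 1) := by
  ext ⟨s, x⟩
  rw [mem_preimage, mem_prod]
  exact vecCons_mem_cube_iff n s x

/-- `(s,x) ↦ vecCons s x` is measure preserving from `(0,1) × (0,1)ⁿ` to `(0,1)ⁿ⁺¹` (restricted Lebesgue measures). -/
theorem measurePreserving_vecCons_cube (n : ℕ) :
    MeasurePreserving (fun p : ℝ × (Fin n → ℝ) => Matrix.vecCons p.1 p.2)
      (((volume : Measure ℝ).restrict (Ioo 0 1)).prod
        ((volume : Measure (Fin n → ℝ)).restrict (univ.pi fun _ : Fin n => Ioo (0:ℝ) 1)))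
      ((volume : Measure (Fin (n + 1) → ℝ)).restrict (univ.pi fun _ : Fin (n + 1) => Ioo (0:ℝ) 1)) := by
  have hmp := (KZ.measurePreserving_vecCons (n := n)).restrict_preimage_emb KZ.measurableEmbedding_vecCons
    (univ.pi fun _ : Fin (n + 1) => Ioo (0:ℝ) 1)
  rwa [vecCons_preimage_cube, ← Measure.prod_restrict] at hmp

/-- **Product slice of the cube**: `∫_{(0,1)ⁿ⁺¹} f(y₀)·G(y₁,…,yₙ) dy = (∫₀¹ f)·(∫_{(0,1)ⁿ} G)` (no integrability needed). -/
theorem integral_cube_cons_mul (n : ℕ) (f : ℝ → ℂ) (G : (Fin n → ℝ) → ℂ) :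
    ∫ y in (univ.pi fun _ : Fin (n + 1) => Ioo (0:ℝ) 1), f (y 0) * G (fun i => y i.succ) =
      (∫ s in Ioo (0:ℝ) 1, f s) * ∫ x in (univ.pi fun _ : Fin n => Ioo (0:ℝ) 1), G x := by
  rw [← (measurePreserving_vecCons_cube n).integral_comp KZ.measurableEmbedding_vecCons]
  simp only [Matrix.cons_val_zero, Matrix.cons_val_succ]
  exact integral_prod_mul f G

/-- **Integrability of a product slice**: `f(y₀)·G(y₁,…,yₙ)` is integrable on `(0,1)ⁿ⁺¹` if `f` is integrable on
`(0,1)` and `G` on `(0,1)ⁿ`. -/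
theorem integrableOn_cube_cons_mul (n : ℕ) {f : ℝ → ℂ} {G : (Fin n → ℝ) → ℂ} (hf : IntegrableOn f (Ioo 0 1))
    (hG : IntegrableOn G (univ.pi fun _ : Fin n => Ioo (0:ℝ) 1)) :
    IntegrableOn (fun y : Fin (n + 1) → ℝ => f (y 0) * G (fun i => y i.succ))
      (univ.pi fun _ : Fin (n + 1) => Ioo (0:ℝ) 1) := by
  have h := ((measurePreserving_vecCons_cube n).integrable_comp_emb KZ.measurableEmbedding_vecCons
    (g := fun y : Fin (n + 1) → ℝ => f (y 0) * G (fun i => y i.succ))).mp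
  apply h
  simp only [Function.comp_def, Matrix.cons_val_zero, Matrix.cons_val_succ]
  exact hf.mul_prod hG

/-! ### 2. Coordinate reversal of `(0,1)³` for vector-valued integrands -/

/-- `∫_{(0,1)³} g(x₂,x₁,x₀) dx = ∫_{(0,1)³} g(x) dx` for integrands with values in a real normed space. -/
theorem setIntegral_cube3_rev {E : Type*} [NormedAddCommGroup E] [NormedSpace ℝ E] (g : (Fin 3 → ℝ) → E) :
    ∫ x in (univ.pi fun _ : Fin 3 => Ioo (0:ℝ) 1), g ![x 2, x 1, x 0] =
      ∫ x in (univ.pi fun _ : Fin 3 => Ioo (0:ℝ) 1), g x := by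
  let e : (Fin 3 → ℝ) ≃ᵐ (Fin 3 → ℝ) := MeasurableEquiv.piCongrLeft (fun _ : Fin 3 => ℝ) Fin.revPerm
  have he : ∀ x : Fin 3 → ℝ, (e x : Fin 3 → ℝ) = ![x 2, x 1, x 0] := by
    intro x; ext i
    simp only [e, MeasurableEquiv.coe_piCongrLeft, Equiv.piCongrLeft_apply_eq_cast, cast_eq, Fin.revPerm_symm,
      Fin.revPerm_apply]
    fin_cases i <;> rfl
  have hmp : MeasurePreserving e volume volume := volume_measurePreserving_piCongrLeft (fun _ : Fin 3 => ℝ) Fin.revPerm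
  have hpre : e ⁻¹' (univ.pi fun _ : Fin 3 => Ioo (0:ℝ) 1) = (univ.pi fun _ : Fin 3 => Ioo (0:ℝ) 1) := by
    ext x
    simp only [Set.mem_preimage, he, mem_univ_pi, mem_Ioo]
    constructor
    · intro hx i
      fin_cases i
      · simpa using hx 2
      · simpa using hx 1
      · simpa using hx 0
    · intro hx i
      fin_cases i
      · simpa using hx 2
      · simpa using hx 1
      · simpa using hx 0
  have key := hmp.setIntegral_preimage_emb e.measurableEmbedding g (univ.pi fun _ : Fin 3 => Ioo (0:ℝ) 1)
  rw [hpre] at key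
  simpa only [he] using key

/-! ### 3. Domination of the link -/

/-- On the cube, `1 − (1−xy)z ≥ xy` and `≥ 1 − z`. -/
theorem link_ge {x y z : ℝ} (hx : 0 < x ∧ x < 1) (hy : 0 < y ∧ y < 1) (hz : 0 < z ∧ z < 1) :
    x * y ≤ 1 - (1 - x * y) * z ∧ 1 - z ≤ 1 - (1 - x * y) * z := by
  have hxy : 0 < x * y := mul_pos hx.1 hy.1
  have hxy1 : x * y < 1 := by nlinarith [mul_lt_of_lt_one_right hx.1 hy.2]
  constructor
  · nlinarith [mul_nonneg (sub_pos.mpr hz.2).le (sub_pos.mpr hxy1).le]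
  · nlinarith [mul_pos hxy hz.1]

/-- **Domination of the link**: for `α, β ≥ 0`, `(1−(1−xy)z)^{−(α+β)} ≤ (xy)^{−β} · (1−z)^{−α}` on the cube. -/
theorem link_rpow_le {x y z : ℝ} (hx : 0 < x ∧ x < 1) (hy : 0 < y ∧ y < 1) (hz : 0 < z ∧ z < 1) {α β : ℝ}
    (hα : 0 ≤ α) (hβ : 0 ≤ β) :
    (1 - (1 - x * y) * z) ^ (-(α + β)) ≤ (x * y) ^ (-β) * (1 - z) ^ (-α) := by
  obtain ⟨h1, h2⟩ := link_ge hx hy hz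
  have hL := link_pos hx hy hz
  have hxy : 0 < x * y := mul_pos hx.1 hy.1
  have hz' : 0 < 1 - z := by linarith [hz.2]
  rw [show -(α + β) = -β + -α by ring, Real.rpow_add hL]
  exact mul_le_mul (Real.rpow_le_rpow_of_nonpos hxy h1 (by linarith))
    (Real.rpow_le_rpow_of_nonpos hz' h2 (by linarith)) (Real.rpow_nonneg hL.le _) (Real.rpow_nonneg hxy.le _)

/-! ### 4. Integrability of the complex-exponent RV integrand on `(0,1)³` -/

/-- A product of three functions integrable on `(0,1)` is integrable on `(0,1)³`. -/
theorem integrableOn_cube3_prod3 {f0 f1 f2 : ℝ → ℂ} (h0 : IntegrableOn f0 (Ioo 0 1)) (h1 : IntegrableOn f1 (Ioo 0 1))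
    (h2 : IntegrableOn f2 (Ioo 0 1)) :
    IntegrableOn (fun x : Fin 3 → ℝ => f0 (x 0) * f1 (x 1) * f2 (x 2)) (univ.pi fun _ : Fin 3 => Ioo (0:ℝ) 1) := by
  have h := Integrable.fintype_prod (f := (![f0, f1, f2] : Fin 3 → ℝ → ℂ))
    (μ := fun _ : Fin 3 => (volume : Measure ℝ).restrict (Ioo 0 1)) (by
      intro i; fin_cases i <;> assumption)
  simp only [Fin.prod_univ_three, Matrix.cons_val_zero, Matrix.cons_val_one, Matrix.cons_val] at h
  rw [IntegrableOn, volume_pi, Measure.restrict_pi_pi]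
  exact h

/-- The complex-exponent RV integrand is measurable. -/
theorem measurable_rv_cpow (h l k s j q c : ℂ) :
    Measurable (fun x : Fin 3 → ℝ => ((x 0 : ℝ) : ℂ) ^ h * ((1 - x 0 : ℝ) : ℂ) ^ l * ((x 1 : ℝ) : ℂ) ^ k *
      ((1 - x 1 : ℝ) : ℂ) ^ s * ((x 2 : ℝ) : ℂ) ^ j * ((1 - x 2 : ℝ) : ℂ) ^ q /
      ((1 - (1 - x 0 * x 1) * x 2 : ℝ) : ℂ) ^ c) := by
  have m0 : Measurable fun x : Fin 3 → ℝ => ((x 0 : ℝ) : ℂ) := Complex.measurable_ofReal.comp (measurable_pi_apply 0)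
  have m1 : Measurable fun x : Fin 3 → ℝ => ((x 1 : ℝ) : ℂ) := Complex.measurable_ofReal.comp (measurable_pi_apply 1)
  have m2 : Measurable fun x : Fin 3 → ℝ => ((x 2 : ℝ) : ℂ) := Complex.measurable_ofReal.comp (measurable_pi_apply 2)
  have m0' : Measurable fun x : Fin 3 → ℝ => ((1 - x 0 : ℝ) : ℂ) :=
    Complex.measurable_ofReal.comp (measurable_const.sub (measurable_pi_apply 0))
  have m1' : Measurable fun x : Fin 3 → ℝ => ((1 - x 1 : ℝ) : ℂ) :=
    Complex.measurable_ofReal.comp (measurable_const.sub (measurable_pi_apply 1))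
  have m2' : Measurable fun x : Fin 3 → ℝ => ((1 - x 2 : ℝ) : ℂ) :=
    Complex.measurable_ofReal.comp (measurable_const.sub (measurable_pi_apply 2))
  have mL : Measurable fun x : Fin 3 → ℝ => ((1 - (1 - x 0 * x 1) * x 2 : ℝ) : ℂ) :=
    Complex.measurable_ofReal.comp (by fun_prop)
  exact ((((((m0.pow_const h).mul (m0'.pow_const l)).mul (m1.pow_const k)).mul (m1'.pow_const s)).mul
    (m2.pow_const j)).mul (m2'.pow_const q)).div (mL.pow_const c)

/-- The norm of the complex-exponent RV integrand on the cube is the real-exponent integrand. -/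
theorem norm_rv_cpow (h l k s j q c : ℂ) {x : Fin 3 → ℝ} (hx : x ∈ (univ.pi fun _ : Fin 3 => Ioo (0:ℝ) 1)) :
    ‖((x 0 : ℝ) : ℂ) ^ h * ((1 - x 0 : ℝ) : ℂ) ^ l * ((x 1 : ℝ) : ℂ) ^ k *
      ((1 - x 1 : ℝ) : ℂ) ^ s * ((x 2 : ℝ) : ℂ) ^ j * ((1 - x 2 : ℝ) : ℂ) ^ q /
      ((1 - (1 - x 0 * x 1) * x 2 : ℝ) : ℂ) ^ c‖ =
      (x 0) ^ h.re * (1 - x 0) ^ l.re * (x 1) ^ k.re * (1 - x 1) ^ s.re * (x 2) ^ j.re * (1 - x 2) ^ q.re *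
        (1 - (1 - x 0 * x 1) * x 2) ^ (-c.re) := by
  have h0 := mem_cube hx 0; have h1 := mem_cube hx 1; have h2 := mem_cube hx 2
  have a0 : 0 < 1 - x 0 := by linarith [h0.2]
  have a1 : 0 < 1 - x 1 := by linarith [h1.2]
  have a2 : 0 < 1 - x 2 := by linarith [h2.2]
  have hL := link_pos h0 h1 h2
  rw [norm_div, norm_mul, norm_mul, norm_mul, norm_mul, norm_mul, Complex.norm_cpow_eq_rpow_re_of_pos h0.1,
    Complex.norm_cpow_eq_rpow_re_of_pos a0, Complex.norm_cpow_eq_rpow_re_of_pos h1.1,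
    Complex.norm_cpow_eq_rpow_re_of_pos a1, Complex.norm_cpow_eq_rpow_re_of_pos h2.1,
    Complex.norm_cpow_eq_rpow_re_of_pos a2, Complex.norm_cpow_eq_rpow_re_of_pos hL, Real.rpow_neg hL.le,
    div_eq_mul_inv]

/-- Domination step: if `α, β ≥ 0` with `β < Re h + 1`, `β < Re k + 1`, `α < Re q + 1` and the link power is bounded by
`(xy)^{−β}(1−z)^{−α}` on the cube, the complex-exponent RV integrand is integrable on `(0,1)³`. -/
theorem rv_integrableOn_cpow_of_split (h l k s j q c : ℂ) (hl : -1 < l.re) (hs : -1 < s.re) (hj : -1 < j.re)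
    {α β : ℝ} (hβh : β < h.re + 1) (hβk : β < k.re + 1) (hαq : α < q.re + 1)
    (hbound : ∀ x : Fin 3 → ℝ, x ∈ (univ.pi fun _ : Fin 3 => Ioo (0:ℝ) 1) →
      (1 - (1 - x 0 * x 1) * x 2) ^ (-c.re) ≤ (x 0 * x 1) ^ (-β) * (1 - x 2) ^ (-α)) :
    IntegrableOn (fun x : Fin 3 → ℝ => ((x 0 : ℝ) : ℂ) ^ h * ((1 - x 0 : ℝ) : ℂ) ^ l * ((x 1 : ℝ) : ℂ) ^ k *
      ((1 - x 1 : ℝ) : ℂ) ^ s * ((x 2 : ℝ) : ℂ) ^ j * ((1 - x 2 : ℝ) : ℂ) ^ q /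
      ((1 - (1 - x 0 * x 1) * x 2 : ℝ) : ℂ) ^ c) (univ.pi fun _ : Fin 3 => Ioo (0:ℝ) 1) := by
  -- the dominating product of three Beta integrands
  have hΦ := (integrableOn_cube3_prod3
    (integrableOn_beta_Ioo' (a := h - β) (b := l) (by simp; linarith) hl)
    (integrableOn_beta_Ioo' (a := k - β) (b := s) (by simp; linarith) hs)
    (integrableOn_beta_Ioo' (a := j) (b := q - α) hj (by simp; linarith))).norm
  refine Integrable.mono' hΦ (measurable_rv_cpow h l k s j q c).aestronglyMeasurable ?_
  refine ae_restrict_of_forall_mem (measurableSet_cube 3) fun x hx => ?_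
  have h0 := mem_cube hx 0; have h1 := mem_cube hx 1; have h2 := mem_cube hx 2
  have a0 : 0 < 1 - x 0 := by linarith [h0.2]
  have a1 : 0 < 1 - x 1 := by linarith [h1.2]
  have a2 : 0 < 1 - x 2 := by linarith [h2.2]
  have hL := link_pos h0 h1 h2
  rw [norm_rv_cpow h l k s j q c hx]
  simp only [norm_mul, Complex.norm_cpow_eq_rpow_re_of_pos h0.1, Complex.norm_cpow_eq_rpow_re_of_pos h1.1,
    Complex.norm_cpow_eq_rpow_re_of_pos h2.1, show (1 : ℂ) - (x 0 : ℂ) = ((1 - x 0 : ℝ) : ℂ) by push_cast; ring,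
    show (1 : ℂ) - (x 1 : ℂ) = ((1 - x 1 : ℝ) : ℂ) by push_cast; ring,
    show (1 : ℂ) - (x 2 : ℂ) = ((1 - x 2 : ℝ) : ℂ) by push_cast; ring,
    Complex.norm_cpow_eq_rpow_re_of_pos a0, Complex.norm_cpow_eq_rpow_re_of_pos a1,
    Complex.norm_cpow_eq_rpow_re_of_pos a2, Complex.sub_re, Complex.ofReal_re]
  have c0 := h0.1; have c1 := h1.1; have c2 := h2.1
  have hM : 0 ≤ x 0 ^ h.re * (1 - x 0) ^ l.re * x 1 ^ k.re * (1 - x 1) ^ s.re * x 2 ^ j.re * (1 - x 2) ^ q.re := by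
    positivity
  calc x 0 ^ h.re * (1 - x 0) ^ l.re * x 1 ^ k.re * (1 - x 1) ^ s.re * x 2 ^ j.re * (1 - x 2) ^ q.re *
        (1 - (1 - x 0 * x 1) * x 2) ^ (-c.re)
      ≤ x 0 ^ h.re * (1 - x 0) ^ l.re * x 1 ^ k.re * (1 - x 1) ^ s.re * x 2 ^ j.re * (1 - x 2) ^ q.re *
        ((x 0 * x 1) ^ (-β) * (1 - x 2) ^ (-α)) := mul_le_mul_of_nonneg_left (hbound x hx) hM
    _ = x 0 ^ (h.re - β) * (1 - x 0) ^ l.re * (x 1 ^ (k.re - β) * (1 - x 1) ^ s.re) *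
        (x 2 ^ j.re * (1 - x 2) ^ (q.re - α)) := by
        rw [Real.mul_rpow h0.1.le h1.1.le, Real.rpow_sub h0.1, Real.rpow_sub h1.1, Real.rpow_sub a2,
          Real.rpow_neg h0.1.le, Real.rpow_neg h1.1.le, Real.rpow_neg a2.le]
        field_simp

/-- **Absolute convergence of the RV triple integral with complex exponents.** For
`Re h, Re l, Re k, Re s, Re j, Re q > −1` and `Re c < Re h + Re q + 2`, `Re c < Re k + Re q + 2`, the integrand
`x^h(1−x)^l y^k(1−y)^s z^j(1−z)^q (1−(1−xy)z)^{−c}` is integrable on `(0,1)³` (the link vanishes only on `{z = 1, xy = 0}`;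
domination by `(xy)^{−β}(1−z)^{−α}` times the monomials, a product of three Beta integrands). [RV §2; BrownZudilin2022 Sect. 3, (3)] -/
theorem rv_integrableOn_cpow (h l k s j q c : ℂ) (hh : -1 < h.re) (hl : -1 < l.re) (hk : -1 < k.re) (hs : -1 < s.re)
    (hj : -1 < j.re) (hq : -1 < q.re) (hc1 : c.re < h.re + q.re + 2) (hc2 : c.re < k.re + q.re + 2) :
    IntegrableOn (fun x : Fin 3 → ℝ => ((x 0 : ℝ) : ℂ) ^ h * ((1 - x 0 : ℝ) : ℂ) ^ l * ((x 1 : ℝ) : ℂ) ^ k *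
      ((1 - x 1 : ℝ) : ℂ) ^ s * ((x 2 : ℝ) : ℂ) ^ j * ((1 - x 2 : ℝ) : ℂ) ^ q /
      ((1 - (1 - x 0 * x 1) * x 2 : ℝ) : ℂ) ^ c) (univ.pi fun _ : Fin 3 => Ioo (0:ℝ) 1) := by
  rcases le_or_gt c.re 0 with hc | hc
  · -- `Re c ≤ 0`: the link power is bounded by `1`
    refine rv_integrableOn_cpow_of_split h l k s j q c hl hs hj (α := 0) (β := 0) (by linarith) (by linarith)
      (by linarith) fun x hx => ?_
    have h0 := mem_cube hx 0; have h1 := mem_cube hx 1; have h2 := mem_cube hx 2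
    have hL := link_pos h0 h1 h2
    have hxy1 : x 0 * x 1 < 1 := by nlinarith [mul_lt_of_lt_one_right h0.1 h1.2]
    have hL1 : 1 - (1 - x 0 * x 1) * x 2 ≤ 1 := by nlinarith [mul_pos (sub_pos.mpr hxy1) h2.1]
    rw [neg_zero, Real.rpow_zero, Real.rpow_zero, mul_one]
    exact Real.rpow_le_one hL.le hL1 (by linarith)
  · -- `Re c > 0`: split `Re c = α + β`
    obtain ⟨β, hβlo, hβhi⟩ := exists_between (show max 0 (c.re - (q.re + 1)) < min c.re (min h.re k.re + 1) by
      refine max_lt (lt_min hc ?_) (lt_min (by linarith) ?_)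
      · rcases le_total h.re k.re with hle | hle
        · rw [min_eq_left hle]; linarith
        · rw [min_eq_right hle]; linarith
      · rcases le_total h.re k.re with hle | hle
        · rw [min_eq_left hle]; linarith
        · rw [min_eq_right hle]; linarith)
    have hβ0 : 0 ≤ β := le_trans (le_max_left _ _) hβlo.le
    have hβ1 : c.re - (q.re + 1) < β := lt_of_le_of_lt (le_max_right _ _) hβlo
    have hβ2 : β < c.re := lt_of_lt_of_le hβhi (min_le_left _ _)
    have hβ3 : β < min h.re k.re + 1 := lt_of_lt_of_le hβhi (min_le_right _ _)
    have hβh : β < h.re + 1 := lt_of_lt_of_le hβ3 (by linarith [min_le_left h.re k.re])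
    have hβk : β < k.re + 1 := lt_of_lt_of_le hβ3 (by linarith [min_le_right h.re k.re])
    refine rv_integrableOn_cpow_of_split h l k s j q c hl hs hj (α := c.re - β) (β := β) hβh hβk (by linarith)
      fun x hx => ?_
    have h0 := mem_cube hx 0; have h1 := mem_cube hx 1; have h2 := mem_cube hx 2
    have := link_rpow_le h0 h1 h2 (α := c.re - β) (β := β) (by linarith) hβ0
    rwa [show c.re - β + β = c.re by ring] at this

end Summit.KontsevichZagierPeriods.Zeta5Search.RhinViolaIntegrable

end
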